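import Summits.BirchSwinnertonDyer.BirchSwinnertonDyer.Theorems.GenusKolyvaginAtTwoGenusPrimitiveSupplyAtTwoPrimeHeegnerTwinUnramified
import Summits.BirchSwinnertonDyer.BirchSwinnertonDyer.Theorems.GenusKolyvaginAtTwoGenusPrimitiveSupplyAtTwoHabitatCutReach
import Summits.BirchSwinnertonDyer.BirchSwinnertonDyer.Theorems.GenusKolyvaginAtTwoMazurRubinCor34iiDictionary
import Summits.BirchSwinnertonDyer.BirchSwinnertonDyer.Theorems.GenusKolyvaginAtTwoPowDvdShaCardAtTwoRTGenusParity
import Literature.NumberTheory.EllipticCurves.BSDRankZeroDensityProofs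
import HarnessLib

/-!
# Route `GenusKolyvaginAtTwo`, crux U_T `ShaCardDvdPowAtTwoRT` (stmt-BirchSwinnertonDyer-23658), LINE 19 `rational_pair_descent`,
# stub PAIRCOUNT, layer-one input (RANKQ) UNCONDITIONALLY for GENERAL odd `d_K` with `2` split OR inert:
# `#Sel₂(E/ℚ) ∣ 4` and `#Ш(E/ℚ)[2] ∣ 4` from a `2`-Selmer-minimal twin of genus budget `ord₂ C(Wd) ≤ 1`

Seat `bsd-line-gk2-p3` g26 (PROVER seat 3/3, cell `bsd-f1-sign2`), `--supports stmt-BirchSwinnertonDyer-23658` (helper; closes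
nothing).  THEOREMS ONLY (no definition, no named fact, no `sorry`); standard axioms; UNCONDITIONAL (no `h33`, no «`2` split»,
no `ρ̄`-hypothesis).  BSD is NOT proved by any of this; neither is U_T nor any stub.

WHY (LEAD gk2-p1 g19, LINE 19 v1.1; cell bus 2026-08-29T22:23:29Z gk2-p5 g29).  The registered stub PAIRCOUNT
`stub_shaRatCardDvdOfMinimalTwin` carries U_T's frame (`W/ℚ` globally minimal, `C(W)` odd, `Δ_W < 0`, `K` imaginary quadratic with
odd `d_K`, Heegner for `N_W` — NO hypothesis on the prime `2` in `K`) and a `2`-Selmer-minimal globally minimal twin `Wd ≅ W^(d_K)`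
with `#Sel₂(Wd) = 2`, `padicValNat 2 Wd.tamagawaProduct ≤ 1`; its (RANKQ) input is `#Ш(E/ℚ)[2] ≤ 4`.  In the tree before this file:
gk2-p5 g20's `GenusKolyTwin.natCard_selmerGroup_two_dvd_four_of_genusBudget_one` (general odd `d_K`, but «`2` SPLIT in `K`», via
Mazur–Rubin Prop. 3.3 = `prop33_rat_holds`) and gk2-p5 g12's `GenusKolyTwin.cor34i_twin_prime_heegner_unramified` (`2` split OR
inert, but PRIME `d_K = −ℓ`).  This file closes the gap «general odd `d_K` × `2` inert»: the several-ramified-primes port of the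
five-row place menu (the other primes of `d_K` are SILENT — row 4 — by the `T`-extraction from `ord₂ C(Wd) = 1`).

* §1 `natCard_sha_torsionBy_dvd_natCard_selmerGroup` — **`#Ш(E/K)[n] ∣ #Sel^(n)(E/K)`** (any elliptic `E` over a number field,
  `n ≥ 1`; the tree's exact descent count `WeierstrassCurve.natCard_selmerGroup_eq`).
* §2 `valuation_discr_eq_exp_neg_one_of_dvd` — `v_q(d_K) = 1` at a prime `q ∣ d_K` of a quadratic field with odd `d_K` (square-free);
  **`twist_place_menu₅_finite_rat_of_silent`** — the FIVE-row finite place menu over `ℚ` for a Heegner twin with GENERAL odd `d_K`: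
  every finite `v ≠ v₀` is on the menu {split | Tamagawa-odd | good both | SILENT both | unramified good}, given that the primes of
  `d_K` other than `v₀` are silent for `W` and `Wd` (port of gk2-p5's `twist_place_menu₅_finite_rat`, `d_K = −ℓ`, where this case is void).
* §3 **`cor34i_twin_heegner_transposition_unramified`** — MR Cor. 3.4 (i) for the Heegner twin at GENERAL odd `d_K`, `2` split OR
  inert: with `q ∣ d_K` a transposition prime (`#W(ℚ_q)[2] = 2`) and every other prime of `d_K` silent (`W(ℚ_p)[2] = 0`):
  `Sel₂(W)` strict at `q` ⟹ `#Sel₂(Wd) = 2·#Sel₂(W)`, not strict ⟹ `#Sel₂(W) = 2·#Sel₂(Wd)` (the kernel engine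
  `GenusKolyTwistLocal.natCard_selmerGroup_twist_directed_of_menu₅_frame` on §2's menu).
* §4 **`natCard_selmerGroup_two_dvd_four_of_genusBudget_le_one_unramified`** — on PAIRCOUNT's exact hypotheses (`C(W)` odd, `Δ_W < 0`,
  `ord₂ C(Wd) ≤ 1`, `#Sel₂(Wd) = 2`; no «`2` split»): **`#Sel₂(W) ∣ 4`** (the `T`-extraction is gk2-p5 g20's
  `exists_transposition_prime_of_padicValNat_two_tamagawaProduct_twin_eq_one`, `ord₂ C(Wd) = 1` by genus parity on `Δ < 0`); and
  **`natCard_sha_torsionBy_two_dvd_four_of_genusBudget_le_one_unramified`** — **`#Ш(E/ℚ)[2] ∣ 4`** (§1).  (RANKQ) delivered.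

References: [MazurRubin2010] Thm. 2.7, Lemmas 2.9–2.11, Prop. 3.3, Cor. 3.4 (i); [Kramer1981] §2 Prop. 3, Thm. 1; [Mazur1972] Cor. 4.4;
[MilneADT2006] I Thm. 2.8, 4.10; [GrossLMS1991] §1 (p. 235); [SilvermanAEC2009] Thm. X.4.2.
-/

set_option linter.dupNamespace false -- tree convention: `Summit.BirchSwinnertonDyer.BirchSwinnertonDyer.Theorems` (summit = sub-problem)
set_option autoImplicit false

noncomputable section

open scoped Classical ContRepresentation

namespace Summit.BirchSwinnertonDyer.BirchSwinnertonDyer.Theorems.GenusExact.PlusDescent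

open WeierstrassCurve Field NumberField IsDedekindDomain Function
open Literature.NumberTheory.EllipticCurves Literature.NumberTheory.GaloisRepresentations
open Literature.NumberTheory.GaloisRepresentations.IsNonarchimedeanLocalField (maxUnramified)
open Literature.NumberTheory.GaloisCohomology
open Literature.NumberTheory.QuadraticFields
open Summit.BirchSwinnertonDyer.BirchSwinnertonDyer.Theorems.GenusKolyTwistLocal
open Rat.HeightOneSpectrum (primesEquiv natGenerator)
open Literature.NumberTheory.DiophantineGeometry.UniformABCConjecture (natCast_mem_asIdeal_iff valuation_natCast_eq_one_iff)

/-! ## §1 `#Ш(E/K)[n] ∣ #Sel^(n)(E/K)` -/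

section ShaDvdSelmer

variable {K : Type} [Field K] [NumberField K] (W : WeierstrassCurve K) [W.IsElliptic]

/-- **`#Ш(E/K)[n] ∣ #Sel^(n)(E/K)`** for an elliptic curve over a number field and `n ≥ 1`: immediate from the exact descent count
`#Sel^(n)(E/K) = n^{rk E(K)} · #E(K)[n] · #(Ш ⊓ H¹(K,E)[n])` (tree `WeierstrassCurve.natCard_selmerGroup_eq`) and `#(Ш[n]) = #(Ш ⊓ H¹[n])`
(`Literature.Algebra.Module.natCard_torsionBy_addSubgroup`).  [cite: SilvermanAEC2009, Thm. X.4.2] -/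
theorem natCard_sha_torsionBy_dvd_natCard_selmerGroup {n : ℕ} (hn : n ≠ 0) :
    Nat.card (AddSubgroup.torsionBy W.sha (n : ℤ)) ∣ Nat.card (W.selmerGroup n) := by
  rw [W.natCard_selmerGroup_eq hn, Literature.Algebra.Module.natCard_torsionBy_addSubgroup]
  exact Dvd.intro_left _ rfl

end ShaDvdSelmer

/-! ## §2 The five-row finite menu for a Heegner twin with general odd `d_K` -/

section Menu

variable (W : WeierstrassCurve ℚ) [W.IsElliptic] [W.IsGloballyMinimal]

omit [W.IsElliptic] [W.IsGloballyMinimal] in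
/-- **`v(d_K) = exp(−1)` at a prime `q ∣ d_K` of a quadratic field with odd (hence square-free) discriminant**, `v` the place of `ℚ`
over `q`: `|d_K| = q·m` with `q ∤ m`.  [cite: Marcus2018, Ch. 2 Thm. 1] -/
theorem valuation_discr_eq_exp_neg_one_of_dvd {K : Type} [Field K] [NumberField K] (h2 : Module.finrank ℚ K = 2)
    (hodd : Odd (discr K)) (v : HeightOneSpectrum (𝓞 ℚ)) {q : ℕ} (hq : q.Prime) (hqv : (q : 𝓞 ℚ) ∈ v.asIdeal)
    (hqd : (q : ℤ) ∣ discr K) : v.valuation ℚ (discr K : ℚ) = WithZero.exp (-1 : ℤ) := by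
  have hsf : Squarefree (discr K) := by
    rcases Quadratic.isFundamentalDiscriminant_discr (K := K) h2 with h | h
    · exact h.2.1
    · exfalso
      obtain ⟨e, he⟩ := h.1
      exact (Int.not_even_iff_odd.mpr hodd) ⟨2 * e, by rw [he]; ring⟩
  obtain ⟨m, hm⟩ : q ∣ (discr K).natAbs := Int.natCast_dvd.mp hqd
  have hqm : ¬ q ∣ m := by
    rintro ⟨e, rfl⟩
    have hsq : q * q ∣ (discr K).natAbs := ⟨e, by rw [hm]; ring⟩
    exact hq.one_lt.ne' (Nat.isUnit_iff.mp (Int.squarefree_natAbs.mpr hsf q hsq))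
  have hgen : natGenerator v = q := by
    have hdvd := (natCast_mem_asIdeal_iff v q).mp hqv
    exact (Nat.prime_dvd_prime_iff_eq (Rat.HeightOneSpectrum.prime_natGenerator v) hq).mp hdvd
  have hvm : v.valuation ℚ (m : ℚ) = 1 := (valuation_natCast_eq_one_iff v m).mpr (by rwa [hgen])
  have hvq : v.valuation ℚ (q : ℚ) = WithZero.exp (-1 : ℤ) :=
    GenusKolyTwistRamified.valuation_natCast_eq_exp_neg_one_of_mem v hq hqv
  have habs : ((discr K).natAbs : ℚ) = (q : ℚ) * (m : ℚ) := by rw [hm]; push_cast; ring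
  rcases Int.natAbs_eq (discr K) with h | h
  · rw [← Int.cast_inj (α := ℚ)] at h
    rw [h, Int.cast_natCast, habs, Valuation.map_mul, hvq, hvm, mul_one]
  · rw [← Int.cast_inj (α := ℚ)] at h
    rw [h, Int.cast_neg, Int.cast_natCast, Valuation.map_neg, habs, Valuation.map_mul, hvq, hvm, mul_one]

/-- **The FIVE-row finite place menu over `ℚ` for a Heegner twin with GENERAL odd `d_K`.**  `W/ℚ` globally minimal, `K` quadratic
with odd `d_K`, Heegner for `N_W`, `v₀` any finite place, `C • W^{(d_K)} = Wd`; HYPOTHESIS: every prime of `d_K` other than (the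
prime under) `v₀` is SILENT for `W` and for `Wd` (`#W(ℚ_v)[2] = #Wd(ℚ_v)[2] = 1`).  Then every finite `v ≠ v₀` is on the five-row
menu — over a prime of `N_W`: split (Heegner); over `2 ∤ N_W`: split if `2` splits in `K`, otherwise (`2 ∤ d_K`) `ι√d_K ∈ ℚ₂^{nr}` and
`W` GOOD at `2` (unramified-good row); over an odd prime of `d_K`: silent (row 4); over an odd prime `∤ d_K N_W`: good for both.
Port of gk2-p5's `twist_place_menu₅_finite_rat` (`d_K = −ℓ`, where row 4 is void).
[cite: MazurRubin2010, Prop. 3.3 (hypotheses), Lemma 2.10 (i), (ii), (v)] [cite: GrossLMS1991, §1 (p. 235)] [cite: Mazur1972, Cor. 4.4] -/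
theorem twist_place_menu₅_finite_rat_of_silent {K : Type} [Field K] [NumberField K]
    (h2 : Module.finrank ℚ K = 2) (hodd : Odd (discr K)) (hH : SatisfiesHeegnerHypothesis (W.conductorNorm ℤ) K)
    (v₀ : HeightOneSpectrum (𝓞 ℚ))
    {Wd : WeierstrassCurve ℚ} {C : VariableChange ℚ} (hC : C • W.quadraticTwist (discr K : ℚ) = Wd)
    (hsil : ∀ v : HeightOneSpectrum (𝓞 ℚ), v ≠ v₀ → (((primesEquiv v : Nat.Primes) : ℕ) : ℤ) ∣ discr K →
      Nat.card (nsmulAddMonoidHom 2 : (W.baseChange (v.adicCompletion ℚ)).toAffine.Point →+ _).ker = 1 ∧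
      Nat.card (nsmulAddMonoidHom 2 : (Wd.baseChange (v.adicCompletion ℚ)).toAffine.Point →+ _).ker = 1) :
    ∀ v : HeightOneSpectrum (𝓞 ℚ), v ≠ v₀ →
      (∃ s : v.adicCompletion ℚ, s ^ 2 = algebraMap ℚ (v.adicCompletion ℚ) (discr K : ℚ)) ∨
      (((2 : ℕ) : 𝓞 ℚ) ∉ v.asIdeal ∧
        ¬ 2 ∣ (W.baseChange (v.adicCompletion ℚ)).localTamagawaNumber (v.adicCompletionIntegers ℚ) ∧
        ¬ 2 ∣ (Wd.baseChange (v.adicCompletion ℚ)).localTamagawaNumber (v.adicCompletionIntegers ℚ)) ∨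
      (((2 : ℕ) : 𝓞 ℚ) ∉ v.asIdeal ∧ W.HasGoodReductionAt v ∧ Wd.HasGoodReductionAt v) ∨
      (((2 : ℕ) : 𝓞 ℚ) ∉ v.asIdeal ∧
        Nat.card (nsmulAddMonoidHom 2 : (W.baseChange (v.adicCompletion ℚ)).toAffine.Point →+ _).ker = 1 ∧
        Nat.card (nsmulAddMonoidHom 2 : (Wd.baseChange (v.adicCompletion ℚ)).toAffine.Point →+ _).ker = 1) ∨
      ((W.HasGoodReductionAt v ∨ (W.HasMultiplicativeReductionAt v ∧ Odd (W.ordMinimalDiscriminant v))) ∧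
        closureEmb (K := ℚ) (v.adicCompletion ℚ) (geomSqrt (discr K : ℚ)) ∈ maxUnramified (v.adicCompletion ℚ)) := by
  intro v hv
  haveI := Fact.mk (primesEquiv v).2
  set p : ℕ := ((primesEquiv v : Nat.Primes) : ℕ) with hp
  have hpP : p.Prime := (primesEquiv v).2
  have hpv : (p : 𝓞 ℚ) ∈ v.asIdeal := Rat.HeightOneSpectrum.natCast_natGenerator_mem v
  by_cases hpN : p ∣ W.conductorNorm ℤ
  · -- a prime of `N_W` splits in `K` (Heegner): `d_K` is a square in `ℚ_v`
    exact Or.inl (exists_sq_eq_discr_adicCompletion_of_ncard_primesOver h2 v (hH p hpP hpN))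
  · have hW : W.HasGoodReductionAt v := by
      by_contra h
      exact hpN ((W.dvd_conductorNorm_iff v).mpr h)
    by_cases hp2 : p = 2
    · -- over `2 ∤ N_W`: `W` good at `2`; `2` split in `K` (row 1) or not split, `2 ∤ d_K` (row 5)
      by_cases hs2 : ((Ideal.span {(2 : ℤ)}).primesOver (𝓞 K)).ncard = 2
      · refine Or.inl (exists_sq_eq_discr_adicCompletion_of_ncard_primesOver h2 v ?_)
        rw [← hp, hp2]
        exact hs2
      · have hp2' : ((primesEquiv v : Nat.Primes) : ℕ) = 2 := by rw [← hp]; exact hp2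
        obtain ⟨x, -, hx⟩ := exists_sq_eq_discr_not_mem_range K h2
        have hx' : x ^ 2 = ((discr K : ℤ) : K) := by rw [hx, map_intCast]
        have hsf : Squarefree (discr K) := by
          rcases Quadratic.isFundamentalDiscriminant_discr (K := K) h2 with h | h
          · exact h.2.1
          · exfalso
            obtain ⟨e, he⟩ := h.1
            exact (Int.not_even_iff_odd.mpr hodd) ⟨2 * e, by rw [he]; ring⟩
        have hd1 : discr K ≠ 1 := by
          have h3 := NumberField.abs_discr_gt_two (K := K) (by rw [h2]; norm_num)
          intro h1
          rw [h1] at h3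
          norm_num at h3
        have h2d : ¬ (2 : ℤ) ∣ discr K := fun h ↦ (Int.not_even_iff_odd.mpr hodd) (even_iff_two_dvd.mpr h)
        have hs2' : ¬ ((Ideal.span {(((primesEquiv v : Nat.Primes) : ℕ) : ℤ)}).primesOver (𝓞 K)).ncard = 2 := by
          rw [hp2', Nat.cast_ofNat]; exact hs2
        have h2d' : ¬ (((primesEquiv v : Nat.Primes) : ℕ) : ℤ) ∣ discr K := by
          rw [hp2', Nat.cast_ofNat]; exact h2d
        exact Or.inr (Or.inr (Or.inr (Or.inr ⟨Or.inl hW,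
          GenusKolyTwistTamagawa.closureEmb_mem_maxUnramified_of_not_split h2 hx' hsf hd1 v hp2' hs2' h2d'⟩)))
    · have h2v : ((2 : ℕ) : 𝓞 ℚ) ∉ v.asIdeal :=
        GenusKolyTwistingPrime.natCast_not_mem_of_not_dvd hpP hpv fun h ↦
          hp2 ((Nat.prime_dvd_prime_iff_eq hpP Nat.prime_two).mp h)
      by_cases hpd : (p : ℤ) ∣ discr K
      · -- an odd prime of `d_K` other than `v₀`: SILENT for both (row 4)
        obtain ⟨hsW, hsWd⟩ := hsil v hv hpd
        exact Or.inr (Or.inr (Or.inr (Or.inl ⟨h2v, hsW, hsWd⟩)))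
      · -- `p ∤ 2 d_K N_W`: odd, good for `W` and for `Wd`
        have hpd' : ¬ ((p : ℕ) : ℤ) ∣ 2 * discr K := by
          intro h
          rcases (Nat.prime_iff_prime_int.mp hpP).dvd_or_dvd h with h2' | hd'
          · exact hp2 ((Nat.prime_dvd_prime_iff_eq hpP Nat.prime_two).mp (by exact_mod_cast h2'))
          · exact hpd hd'
        exact Or.inr (Or.inr (Or.inl ⟨h2v, hW, hasGoodReductionAt_of_smul_quadraticTwist W v hpd' hW hC⟩))

end Menu

/-! ## §3 Cor. 3.4 (i) for the Heegner twin at general odd `d_K`, `2` split or inert -/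

section Cor34i

variable (W : WeierstrassCurve ℚ) [W.IsElliptic] [W.IsGloballyMinimal]

/-- **MR COR. 3.4 (i) FOR THE HEEGNER TWIN AT GENERAL ODD `d_K`, `2` SPLIT OR INERT, UNCONDITIONALLY.**  `W/ℚ` globally minimal
elliptic with `Δ_W < 0`; `K` imaginary quadratic with odd `d_K`, Heegner for `N_W`; `q ∣ d_K` a TRANSPOSITION prime (`#W(ℚ_q)[2] = 2`)
and every other prime of `d_K` SILENT (`W(ℚ_p)[2] = 0`); `Wd ≅ W^{(d_K)}` any elliptic model.  Then `Sel₂(W)` strict at `q` ⟹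
`#Sel₂(Wd) = 2·#Sel₂(W)`, and not strict ⟹ `#Sel₂(W) = 2·#Sel₂(Wd)`.  The only `T`-place is `v_q` (`q ∤ 2N_W` good, `v_q(d_K) = 1`
ramified); every other finite place is on the five-row menu (§2; at the other primes of `d_K` row 4, `#Wd(ℚ_p)[2] = #W(ℚ_p)[2] = 1`),
the real place has `H¹ = 0` for both (`Δ < 0`).  Generalises gk2-p5's `GenusKolyTwin.cor34i_twin_prime_heegner_unramified` (`d_K = −ℓ`).
[cite: MazurRubin2010, Thm. 2.7, Lemmas 2.9–2.11, Prop. 3.3, Cor. 3.4 (i)] [cite: Kramer1981, Thm. 1, Props. 3, 7] [cite: Mazur1972, Cor. 4.4]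
[cite: MilneADT2006, I Thm. 2.8, 4.10] [cite: GrossLMS1991, §1 (p. 235)] -/
theorem cor34i_twin_heegner_transposition_unramified {K : Type} [Field K] [NumberField K]
    (hΔ : W.Δ < 0) (hK : IsImaginaryQuadratic K) (hodd : Odd (discr K))
    (hH : SatisfiesHeegnerHypothesis (W.conductorNorm ℤ) K)
    {q : ℕ} [Fact q.Prime] (hqd : (q : ℤ) ∣ discr K)
    (hq2 : Nat.card {Q : (W.baseChange ℚ_[q]).toAffine.Point // 2 • Q = 0} = 2)
    (hT : ∀ (p : ℕ) [Fact p.Prime], (p : ℤ) ∣ discr K → p ≠ q →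
      ∀ Q : (W.baseChange ℚ_[p]).toAffine.Point, 2 • Q = 0 → Q = 0)
    (Wd : WeierstrassCurve ℚ) [Wd.IsElliptic]
    (hWd : ∃ C : VariableChange ℚ, C • W.quadraticTwist (discr K : ℚ) = Wd) :
    (W.selmerGroup 2 ≤ MazurRubin2010.strictLocalKer W ℚ_[q] 2 →
        Nat.card (Wd.selmerGroup 2) = 2 * Nat.card (W.selmerGroup 2)) ∧
      (¬ W.selmerGroup 2 ≤ MazurRubin2010.strictLocalKer W ℚ_[q] 2 →
        Nat.card (W.selmerGroup 2) = 2 * Nat.card (Wd.selmerGroup 2)) := by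
  have hq : q.Prime := Fact.out
  have hq2' : q ≠ 2 := by
    rintro rfl
    exact (Int.not_even_iff_odd.mpr hodd) (even_iff_two_dvd.mpr (by exact_mod_cast hqd))
  have hqN : ¬ q ∣ W.conductorNorm ℤ := fun h ↦ Literature.SatisfiesHeegnerHypothesis.not_dvd_discr hK.1 hH hq h hqd
  -- the place `v₀` of `ℚ` over `q`
  obtain ⟨v₀, hv₀⟩ : ∃ v : HeightOneSpectrum (𝓞 ℚ), ((primesEquiv v : Nat.Primes) : ℕ) = q :=
    ⟨primesEquiv.symm ⟨q, hq⟩, by rw [Equiv.apply_symm_apply]⟩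
  have hqv₀ : (q : 𝓞 ℚ) ∈ v₀.asIdeal := by
    rw [← hv₀]
    exact Rat.HeightOneSpectrum.natCast_natGenerator_mem v₀
  obtain ⟨C, hC⟩ := hWd
  have hd0 : (discr K : ℚ) ≠ 0 := by exact_mod_cast NumberField.discr_ne_zero K
  -- `W` good at `v₀`, `v₀ ∤ 2`
  have hW : W.HasGoodReductionAt v₀ := by
    by_contra h
    exact hqN (hv₀ ▸ (W.dvd_conductorNorm_iff v₀).mpr h)
  have h2v₀ : ((2 : ℕ) : 𝓞 ℚ) ∉ v₀.asIdeal :=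
    GenusKolyTwistingPrime.natCast_not_mem_of_not_dvd hq hqv₀ fun h ↦
      hq2' ((Nat.prime_dvd_prime_iff_eq hq Nat.prime_two).mp h)
  -- `v₀(d_K) = 1`: `ι(√d_K) ∉ ℚ_{v₀}^{nr}`
  have hram : closureEmb (K := ℚ) (v₀.adicCompletion ℚ) (geomSqrt (discr K : ℚ)) ∉ maxUnramified (v₀.adicCompletion ℚ) :=
    GenusKolyTwistRamified.closureEmb_geomSqrt_not_mem_maxUnramified_rat v₀
      (valuation_discr_eq_exp_neg_one_of_dvd hK.1 hodd v₀ hq hqv₀ hqd)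
  -- `#W(ℚ_{v₀})[2] = 2`
  have ht : Nat.card (nsmulAddMonoidHom 2 :
      (W.baseChange (v₀.adicCompletion ℚ)).toAffine.Point →+ _).ker = 2 := by
    rw [natCard_ker_nsmul_adicCompletion_eq_padic W v₀ 2]
    subst hv₀
    exact hq2
  -- the other primes of `d_K` are silent for `W` and `Wd`
  have hsil : ∀ v : HeightOneSpectrum (𝓞 ℚ), v ≠ v₀ → (((primesEquiv v : Nat.Primes) : ℕ) : ℤ) ∣ discr K →
      Nat.card (nsmulAddMonoidHom 2 : (W.baseChange (v.adicCompletion ℚ)).toAffine.Point →+ _).ker = 1 ∧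
      Nat.card (nsmulAddMonoidHom 2 : (Wd.baseChange (v.adicCompletion ℚ)).toAffine.Point →+ _).ker = 1 := by
    intro v hv hpd
    haveI := Fact.mk (primesEquiv v).2
    have hpq : ((primesEquiv v : Nat.Primes) : ℕ) ≠ q := fun h ↦
      hv (primesEquiv.injective (Subtype.ext (h.trans hv₀.symm)))
    have hW1 : Nat.card {Q : (W.baseChange ℚ_[((primesEquiv v : Nat.Primes) : ℕ)]).toAffine.Point // 2 • Q = 0} = 1 :=
      Nat.card_eq_one_iff_exists.mpr ⟨⟨0, nsmul_zero 2⟩, fun Q ↦ Subtype.ext (hT _ hpd hpq Q.1 Q.2)⟩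
    refine ⟨?_, ?_⟩
    · rw [natCard_ker_nsmul_adicCompletion_eq_padic W v 2]
      exact hW1
    · rw [natCard_ker_nsmul_adicCompletion_eq_padic Wd v 2, GenusKolyTwistTamagawa.natCard_twoTorsion_padic_twist_eq W hd0 hC]
      exact hW1
  have h := natCard_selmerGroup_twist_directed_of_menu₅_frame W Wd hd0 hC v₀ h2v₀ hW hram ht
    (twist_place_menu₅_finite_rat_of_silent W hK.1 hodd hH v₀ hC hsil) (twist_place_menu_infinite_rat W hΔ hd0 hC)
  refine ⟨fun hs ↦ ?_, fun hns ↦ ?_⟩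
  · have hstrict : ∀ c ∈ (W.kummerSelmerStructure ((2 : ℕ) : ℤ)).selmerGroup,
        galoisCohomology.localization (W.torsionGaloisModule ((2 : ℕ) : ℤ)) (Sum.inr v₀) 1 c = 0 := by
      apply GenusKolyTwistTamagawa.forall_selmer_localization_eq_zero_of_le_strictLocalKer W v₀
      subst hv₀
      exact hs
    have h1 := h.1 hstrict
    change Nat.card (Wd.selmerGroup 2) = Nat.card (W.selmerGroup 2) * 2 at h1
    omega
  · have hns' : ∃ c ∈ (W.kummerSelmerStructure ((2 : ℕ) : ℤ)).selmerGroup,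
        galoisCohomology.localization (W.torsionGaloisModule ((2 : ℕ) : ℤ)) (Sum.inr v₀) 1 c ≠ 0 := by
      apply exists_selmer_localization_ne_zero_of_not_le_strictLocalKer W v₀
      subst hv₀
      exact hns
    have h2 := h.2 hns'
    change Nat.card (Wd.selmerGroup 2) * 2 = Nat.card (W.selmerGroup 2) at h2
    omega

/-- **`#Sel₂(Wd) = 2 ⟹ #Sel₂(W) ∣ 4` at general odd `d_K`, `2` split OR inert, UNCONDITIONALLY** (hypotheses of
`cor34i_twin_heegner_transposition_unramified`): strict ⟹ `#Sel₂(W) = 1`, not strict ⟹ `#Sel₂(W) = 4`.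
[cite: MazurRubin2010, Cor. 3.4 (i) with Thm. 2.7] [cite: MilneADT2006, I Thm. 4.10] -/
theorem natCard_selmerGroup_two_dvd_four_of_minimalTwin_transposition_unramified {K : Type} [Field K] [NumberField K]
    (hΔ : W.Δ < 0) (hK : IsImaginaryQuadratic K) (hodd : Odd (discr K))
    (hH : SatisfiesHeegnerHypothesis (W.conductorNorm ℤ) K)
    {q : ℕ} [Fact q.Prime] (hqd : (q : ℤ) ∣ discr K)
    (hq2 : Nat.card {Q : (W.baseChange ℚ_[q]).toAffine.Point // 2 • Q = 0} = 2)
    (hT : ∀ (p : ℕ) [Fact p.Prime], (p : ℤ) ∣ discr K → p ≠ q →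
      ∀ Q : (W.baseChange ℚ_[p]).toAffine.Point, 2 • Q = 0 → Q = 0)
    (Wd : WeierstrassCurve ℚ) [Wd.IsElliptic]
    (hWd : ∃ C : VariableChange ℚ, C • W.quadraticTwist (discr K : ℚ) = Wd) (hSel : Nat.card (Wd.selmerGroup 2) = 2) :
    Nat.card (W.selmerGroup 2) ∣ 4 := by
  obtain ⟨hup, hdown⟩ := cor34i_twin_heegner_transposition_unramified W hΔ hK hodd hH hqd hq2 hT Wd hWd
  by_cases hs : W.selmerGroup 2 ≤ MazurRubin2010.strictLocalKer W ℚ_[q] 2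
  · have h := hup hs
    rw [hSel] at h
    exact ⟨4, by omega⟩
  · have h := hdown hs
    rw [hSel] at h
    exact ⟨1, by omega⟩

end Cor34i

/-! ## §4 (RANKQ) on PAIRCOUNT's exact hypotheses — no «`2` split» -/

section RankQ

variable (W : WeierstrassCurve ℚ) [W.IsElliptic] [W.IsGloballyMinimal]

/-- **(RANKQ): `#Sel₂(E/ℚ) ∣ 4` on PAIRCOUNT's exact hypotheses, UNCONDITIONALLY (no «`2` split», no `ρ̄`, no named fact).**  `W/ℚ`
globally minimal elliptic with `Δ_W < 0` and `C(W)` odd; `K` imaginary quadratic with odd `d_K`, Heegner for `N_W`; `Wd ≅ W^{(d_K)}`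
elliptic with `ord₂ C(Wd) ≤ 1` and `#Sel₂(Wd) = 2`.  Then `#Sel₂(W) ∣ 4`.  (`ord₂ C(Wd)` is odd on `Δ < 0`, hence `= 1`; the
`T`-extraction `exists_transposition_prime_of_padicValNat_two_tamagawaProduct_twin_eq_one` (gk2-p5 g20) gives the transposition prime
and the silent primes; §3.)  Compare `GenusKolyTwin.natCard_selmerGroup_two_dvd_four_of_genusBudget_one` («`2` split»).
[cite: MazurRubin2010, Cor. 3.4 (i)] [cite: Kramer1981, §2 Prop. 3, Thm. 1] -/
theorem natCard_selmerGroup_two_dvd_four_of_genusBudget_le_one_unramified {K : Type} [Field K] [NumberField K]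
    (hΔ : W.Δ < 0) (hTam : Odd W.tamagawaProduct) (hK : IsImaginaryQuadratic K) (hodd : Odd (discr K))
    (hH : SatisfiesHeegnerHypothesis (W.conductorNorm ℤ) K)
    (Wd : WeierstrassCurve ℚ) [Wd.IsElliptic] (hWd : ∃ C : VariableChange ℚ, C • W.quadraticTwist (discr K : ℚ) = Wd)
    (hle : padicValNat 2 Wd.tamagawaProduct ≤ 1) (hSel : Nat.card (Wd.selmerGroup 2) = 2) :
    Nat.card (W.selmerGroup 2) ∣ 4 := by
  obtain ⟨Cd, hCd⟩ := hWd
  have hB : padicValNat 2 Wd.tamagawaProduct = 1 := by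
    obtain ⟨k, hk⟩ := odd_padicValNat_two_tamagawaProduct_twin_of_Δ_neg W hK hodd hH hTam hΔ Cd hCd
    omega
  obtain ⟨q₀, hq₀, hq₀d, hq₀2, hT⟩ :=
    GenusKolyTwin.exists_transposition_prime_of_padicValNat_two_tamagawaProduct_twin_eq_one W hK hodd hH hTam Cd hCd hB
  exact natCard_selmerGroup_two_dvd_four_of_minimalTwin_transposition_unramified W hΔ hK hodd hH hq₀d hq₀2 hT Wd ⟨Cd, hCd⟩ hSel

/-- **(RANKQ), `Ш`-form: `#Ш(E/ℚ)[2] ∣ 4` on PAIRCOUNT's exact hypotheses, UNCONDITIONALLY** (`#Ш[2] ∣ #Sel₂ ∣ 4`, §1): the rank input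
of LINE 19's PAIRCOUNT road (with (B2Q) `2^{M₀}·Ш(E/ℚ)[2^∞] = 0` and (CTQ)), now for general odd `d_K` and `2` split OR inert.
[cite: MazurRubin2010, Cor. 3.4 (i)] [cite: SilvermanAEC2009, Thm. X.4.2] -/
theorem natCard_sha_torsionBy_two_dvd_four_of_genusBudget_le_one_unramified {K : Type} [Field K] [NumberField K]
    (hΔ : W.Δ < 0) (hTam : Odd W.tamagawaProduct) (hK : IsImaginaryQuadratic K) (hodd : Odd (discr K))
    (hH : SatisfiesHeegnerHypothesis (W.conductorNorm ℤ) K)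
    (Wd : WeierstrassCurve ℚ) [Wd.IsElliptic] (hWd : ∃ C : VariableChange ℚ, C • W.quadraticTwist (discr K : ℚ) = Wd)
    (hle : padicValNat 2 Wd.tamagawaProduct ≤ 1) (hSel : Nat.card (Wd.selmerGroup 2) = 2) :
    Nat.card (AddSubgroup.torsionBy W.sha (2 : ℤ)) ∣ 4 := by
  have hsha := natCard_sha_torsionBy_dvd_natCard_selmerGroup W (n := 2) two_ne_zero
  simp only [Nat.cast_ofNat] at hsha
  exact hsha.trans (natCard_selmerGroup_two_dvd_four_of_genusBudget_le_one_unramified W hΔ hTam hK hodd hH Wd hWd hle hSel)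

end RankQ

end Summit.BirchSwinnertonDyer.BirchSwinnertonDyer.Theorems.GenusExact.PlusDescent

end
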